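import Summits.BirchSwinnertonDyer.BirchSwinnertonDyer.Theorems.PrintX8VSCSharpFlatMainConjectureContraAtPairIffCruxBodies
import Summits.BirchSwinnertonDyer.BirchSwinnertonDyer.Theorems.PrintX8VSCConjSpanGenAll
import HarnessLib

/-!
# Route `PrintX8VSC`: the RANK-RESTRICTED cruxes K′R / C′R — `MC′ (23742) ⟺ K′R ∧ C′R` modulo the held print packs, and the glue of the
# pen's REPAIR kit #2 (`K′R → C′R → Held → Span → Pub → MC′`) pre-built

Cell `bsd-print-x8`, seat p3 (gen 9; «does BSTW 2024 cover `a_p ≠ 0` at `p = 3`? … no ⇒ the exact missing input is the crux»). Class-level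
sequel of the per-pair files `PrintX8VSCLowerDivisibilityContraOfCruxBodiesAt` / `PrintX8VSCSharpFlatMainConjectureContraAtPairIffCruxBodies`.

The route's research cruxes K′ = `PrintX8VSC.KatoFineLowerSporadicGivenHeldX8Contra` (23732) and C′ =
`PrintX8VSC.CyclotomicLowerPosLevelGivenHeldX8Contra` (23733) quantify over ALL X8 pairs; the derived MC′ =
`PrintX8VSC.SharpFlatMainConjectureX8Contra` (23742) and the route's `closes` only over X8 pairs of analytic rank `≤ 1`. Hence the kernel
sandwich MC₇.₂₁′(X8, all ranks) ⟹ K′ ∧ C′ (p679782 §3) ⟹ MC′ (glue 23743) is not an equivalence: K′/C′ overshoot by the X8 pairs of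
analytic rank `≥ 2` (e.g. `5077a1` at `3`, `r_an = 3`). Write **K′R / C′R** for the SAME TEXT as K′ / C′ (four fact antecedents included)
with the binder `W.analyticRank ≤ 1 →` inserted after `ClassX8 W p →` — the «misstated-class repair» the x8 pen booked as REPAIR kit #2
(PLAN §5 (x), pen g36) should a refutation of K′ or C′ ever come from an X8 pair of analytic rank `≥ 2`. This file shows, with nothing
but the route's own held packs displayed:

* §5 `glueSharpFlatMainConjectureOfKatoSporadicX8ContraR : K′R → C′R → HeldInputsX8RContra → ConjSpanGenAll → PublishedInputsX8Contra →
  SharpFlatMainConjectureX8Contra` — the glue item 23743 with K′, C′ replaced by K′R, C′R (same binder list, so a re-filed glue item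
  closes by this name); proof = the per-pair glue at each pair;
* §6 `katoFineLowerSporadicX8ContraR_of_sharpFlatMainConjectureX8Contra : MC′ → K′R` (fact-free: Thm. 7.14 is K′R's own first antecedent)
  and `cyclotomicLowerPosLevelX8ContraR_of_sharpFlatMainConjectureX8Contra : MC′ → C′R` (fact-free); the trivial weakenings K′ → K′R,
  C′ → C′R;
* §7 `sharpFlatMainConjectureX8Contra_iff_cruxesR : HeldInputsX8RContra → PublishedInputsX8Contra → (MC′ ↔ K′R ∧ C′R)` (THEOREM B =
  `PrintX8VSCGlue.conjSpanGenAll_holds` fed in-kernel).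

READING (p3's sentence, class level): on its own rank window the open content of the route of record is EXACTLY Sprung's Main Conj. 7.21
at `(3, a₃ = ±3)`, `r_an ≤ 1` (item 23742) — equivalently exactly K′R ∧ C′R; BSTW 2024 ((1.7), §1.5) supplies none of it. No route verb is
implied (the pen restates only on a refutation event; ref R-295 DEFER). HONEST FRAMING: plumbing; K′R, C′R, MC′ are OPEN IN PRINT and
appear only as sides of implications; MC 7.21, K′, C′, MC′, the X8 leaf and BSD are NOT proved. beyond-print theorem: no.

References: [Sprung2012] Thm. 7.14, Thm. 7.16 (p. 1504), Prop. 7.19 and Main Conj. 7.21 (p. 1505); [Kato2004Asterisque] Conj. 12.10 (p. 224);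
[BurungaleSkinnerTianWan2024] (1.7) (p. 6), §1.5 (p. 11); [Vaserstein1972SL2] Theorem (p. 313).
-/

set_option linter.dupNamespace false
set_option autoImplicit false

noncomputable section

open scoped Classical NumberField MatrixGroups ModularForm

open NumberField IsDedekindDomain CongruenceSubgroup WeierstrassCurve Field
  Literature.NumberTheory.EllipticCurves Literature.NumberTheory.EllipticCurves.ModularForms
  Literature.NumberTheory.EllipticCurves.ZpExtension Literature.NumberTheory.EllipticCurves.Sprung2017
  Literature.NumberTheory.EllipticCurves.Sprung2012 Literature.NumberTheory.EllipticCurves.Rank1Residual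
  Literature.NumberTheory.EllipticCurves.IwasawaAlgebra Literature.NumberTheory.EllipticCurves.Kato2004
  Literature.NumberTheory.EllipticCurves.Module
  Summit.BirchSwinnertonDyer.BirchSwinnertonDyer.Theorems
  Summit.BirchSwinnertonDyer.BirchSwinnertonDyer.Theorems.SmallImageSignedMuDefect
  Summit.BirchSwinnertonDyer.Rank1Residual.Supersingular
  Summit.BirchSwinnertonDyer.BirchSwinnertonDyer.Theses

namespace Summit.BirchSwinnertonDyer.BirchSwinnertonDyer.Theorems.X8CruxBodiesAtPair

/-! ### §5 The glue of REPAIR kit #2: K′R → C′R → Held → Span → Pub → MC′ -/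

/-- **Glue with RANK-RESTRICTED cruxes.** `K′R → C′R → HeldInputsX8RContra → ConjSpanGenAll → PublishedInputsX8Contra →
SharpFlatMainConjectureX8Contra`, where K′R / C′R are the route decls K′ (23732) / C′ (23733) verbatim with `W.analyticRank ≤ 1 →` inserted
after `ClassX8 W p →`. Per pair of analytic rank `≤ 1`: the guards of K′R/C′R are fed from the packs (`h714`, `h716c`, `h3`, the ι-door
pack), then `ChromaticCommonZeros.sharpFlatMainConjectureContraAt_of_cruxBodiesAt` (THEOREM B in-kernel, so the `ConjSpanGenAll` antecedent
is idle and kept only to match the binder list of item 23743). CONDITIONAL (K′R, C′R OPEN IN PRINT); closes nothing today.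
[cite: Sprung2012, Thm. 7.14, Thm. 7.16 (p. 1504) and Main Conj. 7.21 (p. 1505)] [cite: Kato2004Asterisque, Conj. 12.10 (p. 224)] -/
theorem glueSharpFlatMainConjectureOfKatoSporadicX8ContraR :
    (thm714_sharpFlatSelmerDual_finite_torsion → thm716_sharpFlatCharIdeal_divisibility_contra →
      realPeriodRat_eq_unit_mul_plusPeriod_three → PrintX8VSC.HeldFactsIotaDoorX8Contra →
      ∀ (W : WeierstrassCurve ℚ) [W.IsElliptic] [W.IsGloballyMinimal] (p : ℕ) [Fact p.Prime]
        [ContinuousSMul ℤ_[p] (W.tateModule p)] [Module.Free ℤ_[p] (W.tateModule p)]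
        [Module.Finite ℤ_[p] (W.tateModule p)],
        ClassX8 W p → W.analyticRank ≤ 1 → ∀ (κ : ZpExtension ℚ p) (γ : Field.absoluteGaloisGroup ℚ),
        κ.IsCyclotomic → κ.IsTopGenerator γ → IsCyclotomicVariable p γ →
      ∀ (v : HeightOneSpectrum (𝓞 ℚ)), (p : 𝓞 ℚ) ∈ v.asIdeal →
      ∀ (g : Field.absoluteGaloisGroup (v.adicCompletion ℚ)),
        κ.IsTopGenerator (resGalOfEmb (closureEmb (K := ℚ) (v.adicCompletion ℚ)) g) →
      ∀ (cneg : localPoints W (v.adicCompletion ℚ)) (c : ℕ → localPoints W (v.adicCompletion ℚ)),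
        IsHondaSystem κ (closureEmb (K := ℚ) (v.adicCompletion ℚ)) W (W.frobeniusTrace p) g cneg c →
      ∀ (N : ℕ) (_ : NeZero N) (f : CuspForm (Gamma0 N) 2) (ϖ : ℚ) (Lsharp Lflat : IwasawaAlgebra p),
        IsNewformOf W f → (ϖ : ℝ) * W.realPeriodRat = plusPeriod f →
        IsSprungPair f p (W.frobeniusTrace p) Lsharp Lflat →
      ∀ (I : Kato2004.IwasawaH1Data W p κ γ)
        (Cs : SharpFlatColemanKatoDataContra W p f ϖ κ γ (closureEmb (K := ℚ) (v.adicCompletion ℚ))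
          (W.frobeniusTrace p) g c Chroma.sharp I)
        (Cf : SharpFlatColemanKatoDataContra W p f ϖ κ γ (closureEmb (K := ℚ) (v.adicCompletion ℚ))
          (W.frobeniusTrace p) g c Chroma.flat I),
        Cs.Z = Cf.Z →
      ∀ (Y : W.FineSelmerDualData κ γ⁻¹) (𝔭 : PrimeSpectrum (IwasawaAlgebra p)), 𝔭.asIdeal.height = 1 →
        (p : IwasawaAlgebra p) ∉ 𝔭.asIdeal →
        (¬ ∃ n : ℕ, ((cyclotomicOmega p n).map (Int.castRingHom ℤ_[p]) : PowerSeries ℤ_[p]) ∈ 𝔭.asIdeal) →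
        (∀ (col' : Chroma) (G' : IwasawaAlgebra p),
          iwasawaToPowerSeries p G' =
            PowerSeries.C (ϖ : ℚ_[p]) * iwasawaToPowerSeries p (chromaticL col' Lsharp Lflat) →
          G' ∈ 𝔭.asIdeal) →
        Module.lengthAt (IwasawaAlgebra p) (I.H ⧸ Cs.Z) 𝔭 ≤ Module.lengthAt (IwasawaAlgebra p) Y.X 𝔭) →
    (thm714_sharpFlatSelmerDual_finite_torsion → thm716_sharpFlatCharIdeal_divisibility_contra →
      realPeriodRat_eq_unit_mul_plusPeriod_three → PrintX8VSC.HeldFactsIotaDoorX8Contra →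
      ∀ (W : WeierstrassCurve ℚ) [W.IsElliptic] [W.IsGloballyMinimal] (p : ℕ) [Fact p.Prime]
        [ContinuousSMul ℤ_[p] (W.tateModule p)] [Module.Free ℤ_[p] (W.tateModule p)]
        [Module.Finite ℤ_[p] (W.tateModule p)],
        ClassX8 W p → W.analyticRank ≤ 1 → ∀ (col : Chroma) (κ : ZpExtension ℚ p) (γ : Field.absoluteGaloisGroup ℚ),
        κ.IsCyclotomic → κ.IsTopGenerator γ → IsCyclotomicVariable p γ →
      ∀ (v : HeightOneSpectrum (𝓞 ℚ)), (p : 𝓞 ℚ) ∈ v.asIdeal →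
      ∀ (g : Field.absoluteGaloisGroup (v.adicCompletion ℚ)),
        κ.IsTopGenerator (resGalOfEmb (closureEmb (K := ℚ) (v.adicCompletion ℚ)) g) →
      ∀ (cneg : localPoints W (v.adicCompletion ℚ)) (c : ℕ → localPoints W (v.adicCompletion ℚ)),
        IsHondaSystem κ (closureEmb (K := ℚ) (v.adicCompletion ℚ)) W (W.frobeniusTrace p) g cneg c →
      ∀ (N : ℕ) (_ : NeZero N) (f : CuspForm (Gamma0 N) 2) (ϖ : ℚ) (Lsharp Lflat : IwasawaAlgebra p),
        IsNewformOf W f → (ϖ : ℝ) * W.realPeriodRat = plusPeriod f →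
        IsSprungPair f p (W.frobeniusTrace p) Lsharp Lflat → chromaticL col Lsharp Lflat ≠ 0 →
      ∀ (D : SharpFlatSelmerDualData W κ γ⁻¹ (closureEmb (K := ℚ) (v.adicCompletion ℚ))
          (W.frobeniusTrace p) g c col) [Module.Finite (IwasawaAlgebra p) D.X],
        Module.IsTorsion (IwasawaAlgebra p) D.X →
      ∀ (G : IwasawaAlgebra p),
        iwasawaToPowerSeries p G =
          PowerSeries.C (ϖ : ℚ_[p]) * iwasawaToPowerSeries p (chromaticL col Lsharp Lflat) →
      ∀ (I : Kato2004.IwasawaH1Data W p κ γ)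
        (Cs : SharpFlatColemanKatoDataContra W p f ϖ κ γ (closureEmb (K := ℚ) (v.adicCompletion ℚ))
          (W.frobeniusTrace p) g c Chroma.sharp I)
        (Cf : SharpFlatColemanKatoDataContra W p f ϖ κ γ (closureEmb (K := ℚ) (v.adicCompletion ℚ))
          (W.frobeniusTrace p) g c Chroma.flat I),
        Cs.Z = Cf.Z →
      ∀ 𝔭 : PrimeSpectrum (IwasawaAlgebra p), 𝔭.asIdeal.height = 1 →
        (PowerSeries.X : IwasawaAlgebra p) ∉ 𝔭.asIdeal →
        (∃ j : ℕ, 1 ≤ j ∧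
          ((((Polynomial.cyclotomic (p ^ j) ℤ).comp (Polynomial.X + 1)).map (Int.castRingHom ℤ_[p]) : Polynomial ℤ_[p]) :
            PowerSeries ℤ_[p]) ∈ 𝔭.asIdeal) →
        (∀ (col' : Chroma) (G' : IwasawaAlgebra p),
          iwasawaToPowerSeries p G' =
            PowerSeries.C (ϖ : ℚ_[p]) * iwasawaToPowerSeries p (chromaticL col' Lsharp Lflat) →
          G' ∈ 𝔭.asIdeal) →
        Module.lengthAt (IwasawaAlgebra p) (IwasawaAlgebra p ⧸ Ideal.span {G}) 𝔭 ≤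
          Module.lengthAt (IwasawaAlgebra p) D.X 𝔭) →
    PrintX8VSC.HeldInputsX8RContra → PrintX8VSC.ConjSpanGenAll → PrintX8VSC.PublishedInputsX8Contra →
    PrintX8VSC.SharpFlatMainConjectureX8Contra := by
  intro hK hC hHeld _hSpan hPub
  obtain ⟨h714, h3, hJc, hGZK, hKob, hPack⟩ := hHeld
  obtain ⟨-, -, -, h716c, -, -, -⟩ := hPub
  intro W _ _ p _ hX hr col κ γ hκ hγ hcv v hv g hg cneg c hH N hN f ϖ Lsharp Lflat hf hϖ hSP hcol D
  -- the `ℤ_p`-structure of `T_p E` (instance binders of K′R / C′R)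
  haveI : ContinuousSMul ℤ_[p] (W.tateModule p) := TateModule.continuousSMul_padicInt
  haveI : Module.Free ℤ_[p] (W.tateModule p) := W.module_free_tateModule_holds p
  haveI : Module.Finite ℤ_[p] (W.tateModule p) := W.module_finite_tateModule_holds p
  exact ChromaticCommonZeros.sharpFlatMainConjectureContraAt_of_cruxBodiesAt h714 h716c h3 hJc hGZK hKob W p hX hr
    (hK h714 h716c h3 hPack W p hX hr) (hC h714 h716c h3 hPack W p hX hr) col κ γ hκ hγ hcv v hv g hg cneg c hH N hN f ϖ
    Lsharp Lflat hf hϖ hSP hcol D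

/-! ### §6 MC′ ⟹ K′R, MC′ ⟹ C′R (fact-free); K′ ⟹ K′R, C′ ⟹ C′R (weakening) -/

/-- **Item 23742 ⟹ K′R**, fact-free (Sprung Thm. 7.14, needed for finiteness of the print-keyed dual, is K′R's own first antecedent):
per pair, `katoFineLowerAt_of_sharpFlatMainConjectureContraAt`. OPEN item as hypothesis; nothing asserted.
[cite: Sprung2012, Thm. 7.14 (3) (p. 1504), Prop. 7.19 and Main Conj. 7.21 (p. 1505)] [cite: Kato2004Asterisque, Conj. 12.10 (p. 224)] -/
theorem katoFineLowerSporadicX8ContraR_of_sharpFlatMainConjectureX8Contra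
    (hMC : PrintX8VSC.SharpFlatMainConjectureX8Contra) :
    thm714_sharpFlatSelmerDual_finite_torsion → thm716_sharpFlatCharIdeal_divisibility_contra →
      realPeriodRat_eq_unit_mul_plusPeriod_three → PrintX8VSC.HeldFactsIotaDoorX8Contra →
      ∀ (W : WeierstrassCurve ℚ) [W.IsElliptic] [W.IsGloballyMinimal] (p : ℕ) [Fact p.Prime]
        [ContinuousSMul ℤ_[p] (W.tateModule p)] [Module.Free ℤ_[p] (W.tateModule p)]
        [Module.Finite ℤ_[p] (W.tateModule p)],
        ClassX8 W p → W.analyticRank ≤ 1 → ∀ (κ : ZpExtension ℚ p) (γ : Field.absoluteGaloisGroup ℚ),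
        κ.IsCyclotomic → κ.IsTopGenerator γ → IsCyclotomicVariable p γ →
      ∀ (v : HeightOneSpectrum (𝓞 ℚ)), (p : 𝓞 ℚ) ∈ v.asIdeal →
      ∀ (g : Field.absoluteGaloisGroup (v.adicCompletion ℚ)),
        κ.IsTopGenerator (resGalOfEmb (closureEmb (K := ℚ) (v.adicCompletion ℚ)) g) →
      ∀ (cneg : localPoints W (v.adicCompletion ℚ)) (c : ℕ → localPoints W (v.adicCompletion ℚ)),
        IsHondaSystem κ (closureEmb (K := ℚ) (v.adicCompletion ℚ)) W (W.frobeniusTrace p) g cneg c →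
      ∀ (N : ℕ) (_ : NeZero N) (f : CuspForm (Gamma0 N) 2) (ϖ : ℚ) (Lsharp Lflat : IwasawaAlgebra p),
        IsNewformOf W f → (ϖ : ℝ) * W.realPeriodRat = plusPeriod f →
        IsSprungPair f p (W.frobeniusTrace p) Lsharp Lflat →
      ∀ (I : Kato2004.IwasawaH1Data W p κ γ)
        (Cs : SharpFlatColemanKatoDataContra W p f ϖ κ γ (closureEmb (K := ℚ) (v.adicCompletion ℚ))
          (W.frobeniusTrace p) g c Chroma.sharp I)
        (Cf : SharpFlatColemanKatoDataContra W p f ϖ κ γ (closureEmb (K := ℚ) (v.adicCompletion ℚ))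
          (W.frobeniusTrace p) g c Chroma.flat I),
        Cs.Z = Cf.Z →
      ∀ (Y : W.FineSelmerDualData κ γ⁻¹) (𝔭 : PrimeSpectrum (IwasawaAlgebra p)), 𝔭.asIdeal.height = 1 →
        (p : IwasawaAlgebra p) ∉ 𝔭.asIdeal →
        (¬ ∃ n : ℕ, ((cyclotomicOmega p n).map (Int.castRingHom ℤ_[p]) : PowerSeries ℤ_[p]) ∈ 𝔭.asIdeal) →
        (∀ (col' : Chroma) (G' : IwasawaAlgebra p),
          iwasawaToPowerSeries p G' =
            PowerSeries.C (ϖ : ℚ_[p]) * iwasawaToPowerSeries p (chromaticL col' Lsharp Lflat) →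
          G' ∈ 𝔭.asIdeal) →
        Module.lengthAt (IwasawaAlgebra p) (I.H ⧸ Cs.Z) 𝔭 ≤ Module.lengthAt (IwasawaAlgebra p) Y.X 𝔭 := by
  intro h714 _h716c _h3 _hPack W _ _ p _ _ _ _ hX hr
  exact katoFineLowerAt_of_sharpFlatMainConjectureContraAt h714 W p hX (hMC W p hX hr)

/-- **Item 23742 ⟹ C′R**, fact-free: per pair, `cyclotomicLowerAt_of_sharpFlatMainConjectureContraAt`. OPEN item as hypothesis; nothing
asserted. [cite: Sprung2012, Prop. 7.19 and Main Conj. 7.21 (p. 1505)] -/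
theorem cyclotomicLowerPosLevelX8ContraR_of_sharpFlatMainConjectureX8Contra
    (hMC : PrintX8VSC.SharpFlatMainConjectureX8Contra) :
    thm714_sharpFlatSelmerDual_finite_torsion → thm716_sharpFlatCharIdeal_divisibility_contra →
      realPeriodRat_eq_unit_mul_plusPeriod_three → PrintX8VSC.HeldFactsIotaDoorX8Contra →
      ∀ (W : WeierstrassCurve ℚ) [W.IsElliptic] [W.IsGloballyMinimal] (p : ℕ) [Fact p.Prime]
        [ContinuousSMul ℤ_[p] (W.tateModule p)] [Module.Free ℤ_[p] (W.tateModule p)]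
        [Module.Finite ℤ_[p] (W.tateModule p)],
        ClassX8 W p → W.analyticRank ≤ 1 → ∀ (col : Chroma) (κ : ZpExtension ℚ p) (γ : Field.absoluteGaloisGroup ℚ),
        κ.IsCyclotomic → κ.IsTopGenerator γ → IsCyclotomicVariable p γ →
      ∀ (v : HeightOneSpectrum (𝓞 ℚ)), (p : 𝓞 ℚ) ∈ v.asIdeal →
      ∀ (g : Field.absoluteGaloisGroup (v.adicCompletion ℚ)),
        κ.IsTopGenerator (resGalOfEmb (closureEmb (K := ℚ) (v.adicCompletion ℚ)) g) →
      ∀ (cneg : localPoints W (v.adicCompletion ℚ)) (c : ℕ → localPoints W (v.adicCompletion ℚ)),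
        IsHondaSystem κ (closureEmb (K := ℚ) (v.adicCompletion ℚ)) W (W.frobeniusTrace p) g cneg c →
      ∀ (N : ℕ) (_ : NeZero N) (f : CuspForm (Gamma0 N) 2) (ϖ : ℚ) (Lsharp Lflat : IwasawaAlgebra p),
        IsNewformOf W f → (ϖ : ℝ) * W.realPeriodRat = plusPeriod f →
        IsSprungPair f p (W.frobeniusTrace p) Lsharp Lflat → chromaticL col Lsharp Lflat ≠ 0 →
      ∀ (D : SharpFlatSelmerDualData W κ γ⁻¹ (closureEmb (K := ℚ) (v.adicCompletion ℚ))
          (W.frobeniusTrace p) g c col) [Module.Finite (IwasawaAlgebra p) D.X],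
        Module.IsTorsion (IwasawaAlgebra p) D.X →
      ∀ (G : IwasawaAlgebra p),
        iwasawaToPowerSeries p G =
          PowerSeries.C (ϖ : ℚ_[p]) * iwasawaToPowerSeries p (chromaticL col Lsharp Lflat) →
      ∀ (I : Kato2004.IwasawaH1Data W p κ γ)
        (Cs : SharpFlatColemanKatoDataContra W p f ϖ κ γ (closureEmb (K := ℚ) (v.adicCompletion ℚ))
          (W.frobeniusTrace p) g c Chroma.sharp I)
        (Cf : SharpFlatColemanKatoDataContra W p f ϖ κ γ (closureEmb (K := ℚ) (v.adicCompletion ℚ))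
          (W.frobeniusTrace p) g c Chroma.flat I),
        Cs.Z = Cf.Z →
      ∀ 𝔭 : PrimeSpectrum (IwasawaAlgebra p), 𝔭.asIdeal.height = 1 →
        (PowerSeries.X : IwasawaAlgebra p) ∉ 𝔭.asIdeal →
        (∃ j : ℕ, 1 ≤ j ∧
          ((((Polynomial.cyclotomic (p ^ j) ℤ).comp (Polynomial.X + 1)).map (Int.castRingHom ℤ_[p]) : Polynomial ℤ_[p]) :
            PowerSeries ℤ_[p]) ∈ 𝔭.asIdeal) →
        (∀ (col' : Chroma) (G' : IwasawaAlgebra p),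
          iwasawaToPowerSeries p G' =
            PowerSeries.C (ϖ : ℚ_[p]) * iwasawaToPowerSeries p (chromaticL col' Lsharp Lflat) →
          G' ∈ 𝔭.asIdeal) →
        Module.lengthAt (IwasawaAlgebra p) (IwasawaAlgebra p ⧸ Ideal.span {G}) 𝔭 ≤
          Module.lengthAt (IwasawaAlgebra p) D.X 𝔭 := by
  intro _h714 _h716c _h3 _hPack W _ _ p _ _ _ _ hX hr
  exact cyclotomicLowerAt_of_sharpFlatMainConjectureContraAt W p (hMC W p hX hr)

/-- **K′ ⟹ K′R** (the rank-restricted statement is a weakening of the route decl 23732: a proof of K′ closes K′R). [folklore] -/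
theorem katoFineLowerSporadicX8ContraR_of_katoFineLowerSporadicGivenHeldX8Contra
    (hK : PrintX8VSC.KatoFineLowerSporadicGivenHeldX8Contra) :
    thm714_sharpFlatSelmerDual_finite_torsion → thm716_sharpFlatCharIdeal_divisibility_contra →
      realPeriodRat_eq_unit_mul_plusPeriod_three → PrintX8VSC.HeldFactsIotaDoorX8Contra →
      ∀ (W : WeierstrassCurve ℚ) [W.IsElliptic] [W.IsGloballyMinimal] (p : ℕ) [Fact p.Prime]
        [ContinuousSMul ℤ_[p] (W.tateModule p)] [Module.Free ℤ_[p] (W.tateModule p)]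
        [Module.Finite ℤ_[p] (W.tateModule p)],
        ClassX8 W p → W.analyticRank ≤ 1 → ∀ (κ : ZpExtension ℚ p) (γ : Field.absoluteGaloisGroup ℚ),
        κ.IsCyclotomic → κ.IsTopGenerator γ → IsCyclotomicVariable p γ →
      ∀ (v : HeightOneSpectrum (𝓞 ℚ)), (p : 𝓞 ℚ) ∈ v.asIdeal →
      ∀ (g : Field.absoluteGaloisGroup (v.adicCompletion ℚ)),
        κ.IsTopGenerator (resGalOfEmb (closureEmb (K := ℚ) (v.adicCompletion ℚ)) g) →
      ∀ (cneg : localPoints W (v.adicCompletion ℚ)) (c : ℕ → localPoints W (v.adicCompletion ℚ)),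
        IsHondaSystem κ (closureEmb (K := ℚ) (v.adicCompletion ℚ)) W (W.frobeniusTrace p) g cneg c →
      ∀ (N : ℕ) (_ : NeZero N) (f : CuspForm (Gamma0 N) 2) (ϖ : ℚ) (Lsharp Lflat : IwasawaAlgebra p),
        IsNewformOf W f → (ϖ : ℝ) * W.realPeriodRat = plusPeriod f →
        IsSprungPair f p (W.frobeniusTrace p) Lsharp Lflat →
      ∀ (I : Kato2004.IwasawaH1Data W p κ γ)
        (Cs : SharpFlatColemanKatoDataContra W p f ϖ κ γ (closureEmb (K := ℚ) (v.adicCompletion ℚ))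
          (W.frobeniusTrace p) g c Chroma.sharp I)
        (Cf : SharpFlatColemanKatoDataContra W p f ϖ κ γ (closureEmb (K := ℚ) (v.adicCompletion ℚ))
          (W.frobeniusTrace p) g c Chroma.flat I),
        Cs.Z = Cf.Z →
      ∀ (Y : W.FineSelmerDualData κ γ⁻¹) (𝔭 : PrimeSpectrum (IwasawaAlgebra p)), 𝔭.asIdeal.height = 1 →
        (p : IwasawaAlgebra p) ∉ 𝔭.asIdeal →
        (¬ ∃ n : ℕ, ((cyclotomicOmega p n).map (Int.castRingHom ℤ_[p]) : PowerSeries ℤ_[p]) ∈ 𝔭.asIdeal) →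
        (∀ (col' : Chroma) (G' : IwasawaAlgebra p),
          iwasawaToPowerSeries p G' =
            PowerSeries.C (ϖ : ℚ_[p]) * iwasawaToPowerSeries p (chromaticL col' Lsharp Lflat) →
          G' ∈ 𝔭.asIdeal) →
        Module.lengthAt (IwasawaAlgebra p) (I.H ⧸ Cs.Z) 𝔭 ≤ Module.lengthAt (IwasawaAlgebra p) Y.X 𝔭 :=
  fun h714 h716c h3 hPack W _ _ p _ _ _ _ hX _ => hK h714 h716c h3 hPack W p hX

/-- **C′ ⟹ C′R** (weakening of the route decl 23733). [folklore] -/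
theorem cyclotomicLowerPosLevelX8ContraR_of_cyclotomicLowerPosLevelGivenHeldX8Contra
    (hC : PrintX8VSC.CyclotomicLowerPosLevelGivenHeldX8Contra) :
    thm714_sharpFlatSelmerDual_finite_torsion → thm716_sharpFlatCharIdeal_divisibility_contra →
      realPeriodRat_eq_unit_mul_plusPeriod_three → PrintX8VSC.HeldFactsIotaDoorX8Contra →
      ∀ (W : WeierstrassCurve ℚ) [W.IsElliptic] [W.IsGloballyMinimal] (p : ℕ) [Fact p.Prime]
        [ContinuousSMul ℤ_[p] (W.tateModule p)] [Module.Free ℤ_[p] (W.tateModule p)]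
        [Module.Finite ℤ_[p] (W.tateModule p)],
        ClassX8 W p → W.analyticRank ≤ 1 → ∀ (col : Chroma) (κ : ZpExtension ℚ p) (γ : Field.absoluteGaloisGroup ℚ),
        κ.IsCyclotomic → κ.IsTopGenerator γ → IsCyclotomicVariable p γ →
      ∀ (v : HeightOneSpectrum (𝓞 ℚ)), (p : 𝓞 ℚ) ∈ v.asIdeal →
      ∀ (g : Field.absoluteGaloisGroup (v.adicCompletion ℚ)),
        κ.IsTopGenerator (resGalOfEmb (closureEmb (K := ℚ) (v.adicCompletion ℚ)) g) →
      ∀ (cneg : localPoints W (v.adicCompletion ℚ)) (c : ℕ → localPoints W (v.adicCompletion ℚ)),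
        IsHondaSystem κ (closureEmb (K := ℚ) (v.adicCompletion ℚ)) W (W.frobeniusTrace p) g cneg c →
      ∀ (N : ℕ) (_ : NeZero N) (f : CuspForm (Gamma0 N) 2) (ϖ : ℚ) (Lsharp Lflat : IwasawaAlgebra p),
        IsNewformOf W f → (ϖ : ℝ) * W.realPeriodRat = plusPeriod f →
        IsSprungPair f p (W.frobeniusTrace p) Lsharp Lflat → chromaticL col Lsharp Lflat ≠ 0 →
      ∀ (D : SharpFlatSelmerDualData W κ γ⁻¹ (closureEmb (K := ℚ) (v.adicCompletion ℚ))
          (W.frobeniusTrace p) g c col) [Module.Finite (IwasawaAlgebra p) D.X],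
        Module.IsTorsion (IwasawaAlgebra p) D.X →
      ∀ (G : IwasawaAlgebra p),
        iwasawaToPowerSeries p G =
          PowerSeries.C (ϖ : ℚ_[p]) * iwasawaToPowerSeries p (chromaticL col Lsharp Lflat) →
      ∀ (I : Kato2004.IwasawaH1Data W p κ γ)
        (Cs : SharpFlatColemanKatoDataContra W p f ϖ κ γ (closureEmb (K := ℚ) (v.adicCompletion ℚ))
          (W.frobeniusTrace p) g c Chroma.sharp I)
        (Cf : SharpFlatColemanKatoDataContra W p f ϖ κ γ (closureEmb (K := ℚ) (v.adicCompletion ℚ))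
          (W.frobeniusTrace p) g c Chroma.flat I),
        Cs.Z = Cf.Z →
      ∀ 𝔭 : PrimeSpectrum (IwasawaAlgebra p), 𝔭.asIdeal.height = 1 →
        (PowerSeries.X : IwasawaAlgebra p) ∉ 𝔭.asIdeal →
        (∃ j : ℕ, 1 ≤ j ∧
          ((((Polynomial.cyclotomic (p ^ j) ℤ).comp (Polynomial.X + 1)).map (Int.castRingHom ℤ_[p]) : Polynomial ℤ_[p]) :
            PowerSeries ℤ_[p]) ∈ 𝔭.asIdeal) →
        (∀ (col' : Chroma) (G' : IwasawaAlgebra p),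
          iwasawaToPowerSeries p G' =
            PowerSeries.C (ϖ : ℚ_[p]) * iwasawaToPowerSeries p (chromaticL col' Lsharp Lflat) →
          G' ∈ 𝔭.asIdeal) →
        Module.lengthAt (IwasawaAlgebra p) (IwasawaAlgebra p ⧸ Ideal.span {G}) 𝔭 ≤
          Module.lengthAt (IwasawaAlgebra p) D.X 𝔭 :=
  fun h714 h716c h3 hPack W _ _ p _ _ _ _ hX _ => hC h714 h716c h3 hPack W p hX

/-! ### §7 The class-level equivalence on the route's rank window -/

/-- **MC′ ⟺ K′R ∧ C′R modulo the held packs.** Displaying the route's own packs `HeldInputsX8RContra` (23734: Thm. 7.14, period unit,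
joint Coleman–Kato package, GZK, Kobayashi Cor. 1.3 (i), the ι-door pack) and `PublishedInputsX8Contra` (23741: modularity, Thm. 2.2,
Thm. 7.14, Thm. 7.16 contragredient, Lem. 5.9 all N, period unit, entire `L`) — THEOREM B fed in-kernel
(`PrintX8VSCGlue.conjSpanGenAll_holds`) — the derived item 23742 (Sprung's Main Conj. 7.21 AS PRINTED on X8, `r_an ≤ 1`) is EQUIVALENT to
the conjunction of the rank-restricted cruxes K′R ∧ C′R. p3's sentence at class level: on the route's window the exact missing input is
Main Conj. 7.21 at `(3, ±3)` = K′R ∧ C′R, no more, no less; BSTW 2024 ((1.7)) supplies none of it. Both sides OPEN IN PRINT; nothing is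
asserted; no route verb implied. [cite: Sprung2012, Prop. 7.19 and Main Conj. 7.21 (p. 1505)] [cite: Kato2004Asterisque, Conj. 12.10 (p. 224)]
[cite: BurungaleSkinnerTianWan2024, (1.7) (p. 6) and §1.5 (p. 11)] -/
theorem sharpFlatMainConjectureX8Contra_iff_cruxesR
    (hHeld : PrintX8VSC.HeldInputsX8RContra) (hPub : PrintX8VSC.PublishedInputsX8Contra) :
    PrintX8VSC.SharpFlatMainConjectureX8Contra ↔
    (thm714_sharpFlatSelmerDual_finite_torsion → thm716_sharpFlatCharIdeal_divisibility_contra →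
      realPeriodRat_eq_unit_mul_plusPeriod_three → PrintX8VSC.HeldFactsIotaDoorX8Contra →
      ∀ (W : WeierstrassCurve ℚ) [W.IsElliptic] [W.IsGloballyMinimal] (p : ℕ) [Fact p.Prime]
        [ContinuousSMul ℤ_[p] (W.tateModule p)] [Module.Free ℤ_[p] (W.tateModule p)]
        [Module.Finite ℤ_[p] (W.tateModule p)],
        ClassX8 W p → W.analyticRank ≤ 1 → ∀ (κ : ZpExtension ℚ p) (γ : Field.absoluteGaloisGroup ℚ),
        κ.IsCyclotomic → κ.IsTopGenerator γ → IsCyclotomicVariable p γ →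
      ∀ (v : HeightOneSpectrum (𝓞 ℚ)), (p : 𝓞 ℚ) ∈ v.asIdeal →
      ∀ (g : Field.absoluteGaloisGroup (v.adicCompletion ℚ)),
        κ.IsTopGenerator (resGalOfEmb (closureEmb (K := ℚ) (v.adicCompletion ℚ)) g) →
      ∀ (cneg : localPoints W (v.adicCompletion ℚ)) (c : ℕ → localPoints W (v.adicCompletion ℚ)),
        IsHondaSystem κ (closureEmb (K := ℚ) (v.adicCompletion ℚ)) W (W.frobeniusTrace p) g cneg c →
      ∀ (N : ℕ) (_ : NeZero N) (f : CuspForm (Gamma0 N) 2) (ϖ : ℚ) (Lsharp Lflat : IwasawaAlgebra p),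
        IsNewformOf W f → (ϖ : ℝ) * W.realPeriodRat = plusPeriod f →
        IsSprungPair f p (W.frobeniusTrace p) Lsharp Lflat →
      ∀ (I : Kato2004.IwasawaH1Data W p κ γ)
        (Cs : SharpFlatColemanKatoDataContra W p f ϖ κ γ (closureEmb (K := ℚ) (v.adicCompletion ℚ))
          (W.frobeniusTrace p) g c Chroma.sharp I)
        (Cf : SharpFlatColemanKatoDataContra W p f ϖ κ γ (closureEmb (K := ℚ) (v.adicCompletion ℚ))
          (W.frobeniusTrace p) g c Chroma.flat I),
        Cs.Z = Cf.Z →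
      ∀ (Y : W.FineSelmerDualData κ γ⁻¹) (𝔭 : PrimeSpectrum (IwasawaAlgebra p)), 𝔭.asIdeal.height = 1 →
        (p : IwasawaAlgebra p) ∉ 𝔭.asIdeal →
        (¬ ∃ n : ℕ, ((cyclotomicOmega p n).map (Int.castRingHom ℤ_[p]) : PowerSeries ℤ_[p]) ∈ 𝔭.asIdeal) →
        (∀ (col' : Chroma) (G' : IwasawaAlgebra p),
          iwasawaToPowerSeries p G' =
            PowerSeries.C (ϖ : ℚ_[p]) * iwasawaToPowerSeries p (chromaticL col' Lsharp Lflat) →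
          G' ∈ 𝔭.asIdeal) →
        Module.lengthAt (IwasawaAlgebra p) (I.H ⧸ Cs.Z) 𝔭 ≤ Module.lengthAt (IwasawaAlgebra p) Y.X 𝔭) ∧
    (thm714_sharpFlatSelmerDual_finite_torsion → thm716_sharpFlatCharIdeal_divisibility_contra →
      realPeriodRat_eq_unit_mul_plusPeriod_three → PrintX8VSC.HeldFactsIotaDoorX8Contra →
      ∀ (W : WeierstrassCurve ℚ) [W.IsElliptic] [W.IsGloballyMinimal] (p : ℕ) [Fact p.Prime]
        [ContinuousSMul ℤ_[p] (W.tateModule p)] [Module.Free ℤ_[p] (W.tateModule p)]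
        [Module.Finite ℤ_[p] (W.tateModule p)],
        ClassX8 W p → W.analyticRank ≤ 1 → ∀ (col : Chroma) (κ : ZpExtension ℚ p) (γ : Field.absoluteGaloisGroup ℚ),
        κ.IsCyclotomic → κ.IsTopGenerator γ → IsCyclotomicVariable p γ →
      ∀ (v : HeightOneSpectrum (𝓞 ℚ)), (p : 𝓞 ℚ) ∈ v.asIdeal →
      ∀ (g : Field.absoluteGaloisGroup (v.adicCompletion ℚ)),
        κ.IsTopGenerator (resGalOfEmb (closureEmb (K := ℚ) (v.adicCompletion ℚ)) g) →
      ∀ (cneg : localPoints W (v.adicCompletion ℚ)) (c : ℕ → localPoints W (v.adicCompletion ℚ)),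
        IsHondaSystem κ (closureEmb (K := ℚ) (v.adicCompletion ℚ)) W (W.frobeniusTrace p) g cneg c →
      ∀ (N : ℕ) (_ : NeZero N) (f : CuspForm (Gamma0 N) 2) (ϖ : ℚ) (Lsharp Lflat : IwasawaAlgebra p),
        IsNewformOf W f → (ϖ : ℝ) * W.realPeriodRat = plusPeriod f →
        IsSprungPair f p (W.frobeniusTrace p) Lsharp Lflat → chromaticL col Lsharp Lflat ≠ 0 →
      ∀ (D : SharpFlatSelmerDualData W κ γ⁻¹ (closureEmb (K := ℚ) (v.adicCompletion ℚ))
          (W.frobeniusTrace p) g c col) [Module.Finite (IwasawaAlgebra p) D.X],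
        Module.IsTorsion (IwasawaAlgebra p) D.X →
      ∀ (G : IwasawaAlgebra p),
        iwasawaToPowerSeries p G =
          PowerSeries.C (ϖ : ℚ_[p]) * iwasawaToPowerSeries p (chromaticL col Lsharp Lflat) →
      ∀ (I : Kato2004.IwasawaH1Data W p κ γ)
        (Cs : SharpFlatColemanKatoDataContra W p f ϖ κ γ (closureEmb (K := ℚ) (v.adicCompletion ℚ))
          (W.frobeniusTrace p) g c Chroma.sharp I)
        (Cf : SharpFlatColemanKatoDataContra W p f ϖ κ γ (closureEmb (K := ℚ) (v.adicCompletion ℚ))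
          (W.frobeniusTrace p) g c Chroma.flat I),
        Cs.Z = Cf.Z →
      ∀ 𝔭 : PrimeSpectrum (IwasawaAlgebra p), 𝔭.asIdeal.height = 1 →
        (PowerSeries.X : IwasawaAlgebra p) ∉ 𝔭.asIdeal →
        (∃ j : ℕ, 1 ≤ j ∧
          ((((Polynomial.cyclotomic (p ^ j) ℤ).comp (Polynomial.X + 1)).map (Int.castRingHom ℤ_[p]) : Polynomial ℤ_[p]) :
            PowerSeries ℤ_[p]) ∈ 𝔭.asIdeal) →
        (∀ (col' : Chroma) (G' : IwasawaAlgebra p),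
          iwasawaToPowerSeries p G' =
            PowerSeries.C (ϖ : ℚ_[p]) * iwasawaToPowerSeries p (chromaticL col' Lsharp Lflat) →
          G' ∈ 𝔭.asIdeal) →
        Module.lengthAt (IwasawaAlgebra p) (IwasawaAlgebra p ⧸ Ideal.span {G}) 𝔭 ≤
          Module.lengthAt (IwasawaAlgebra p) D.X 𝔭) :=
  ⟨fun hMC => ⟨katoFineLowerSporadicX8ContraR_of_sharpFlatMainConjectureX8Contra hMC,
    cyclotomicLowerPosLevelX8ContraR_of_sharpFlatMainConjectureX8Contra hMC⟩,
   fun h => glueSharpFlatMainConjectureOfKatoSporadicX8ContraR h.1 h.2 hHeld PrintX8VSCGlue.conjSpanGenAll_holds hPub⟩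

end Summit.BirchSwinnertonDyer.BirchSwinnertonDyer.Theorems.X8CruxBodiesAtPair

end
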